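import Summits.NavierStokesRegularity.FluidComputer.PalasekTowerTameCarrierAt
import Literature.Analysis.FluidPDE.AxisymmetricEuler
import HarnessLib

/-!
# The strict-slot carrier of record has swirl (Negative lane, `EpisodeBaseT`, line «doormirror» stub D2)

A small-model fact for the crux chain of `EpisodeBaseT` (LADDER-NS N1, item 20303; line «doormirror»,
`Cruxes/EpisodeBaseT/Lines/doormirror.lean`, stub D2 `SterileMechanismDoorT`, whose intended proof begins
with «an axisymmetric swirl-free TAME CARRIER in the strict slot … the coaxial twin of
`Germ.exists_levelZeroDataAt_tame_freeRun_cap`»). The strict-slot carrier OF RECORD is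
`Germ.tameCarrierAt R a λ = tinyProfileAt R a + faintPusher (λ Y₀(R)/Y₀(wide))`
(`Germ.levelZeroDataAt_tameCarrierAt`, which requires `0 < λ`). Its far pusher
`farPusher = ∇ψ × Y₀e₃` with `ψ` RADIAL about the axis point `5e₃` is a PURELY AZIMUTHAL field: at the
documented point `strictPt = 5e₃ + ½e₁` it equals `−(9/64)Y₀ · (e₁ × e₃) = (9/64)Y₀ e₂`
(`Germ.farPusher_strictPt`), so its swirl `Γ = x₀u₁ − x₁u₀` there is `(9/128)Y₀(wide) ≠ 0`. Hence

* `not_hasNoSwirl_farPusher`, `not_hasNoSwirl_faintPusher (λ ≠ 0)`;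
* `not_hasNoSwirl_tameCarrierAt`: for `0 < a ≤ 1/2` and `λ ≠ 0` the carrier of record is NOT swirl-free
  (about its own axis `e₃`) — in particular for every parameter set the slot lemma of record admits
  (`tameCarrierAt_of_record_hasSwirl`, hypotheses verbatim those of `levelZeroDataAt_tameCarrierAt`);
* `hasNoSwirl_translate_axis_iff`: swirl-freeness is invariant under translation ALONG the axis, so no
  coaxial placement `x ↦ U (x + s e₃)` of the carrier of record is swirl-free either
  (`not_hasNoSwirl_tameCarrierAt_translate_axis`).

Reading for the line: D2's «coaxial twin» is not a placement of the existing carrier but a NEW strict-slot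
carrier with a poloidal (swirl-free) far structure, whose anchor face `0 < ⟪U, accel 1 U⟫` at the speed
argmax must be re-derived; the alternative stub D2′ `GlobalDoorDesignT` needs no sterile carrier.

WHAT THIS IS NOT: not Navier–Stokes evidence; not a refutation of D2 (which may well hold with a new
carrier); explicit evaluation of tree objects at one point; sorry-free, std axioms; no item moves.
-/

noncomputable section

open Literature.Analysis.FluidPDE
open Summit.NavierStokesRegularity.FluidComputer.PalasekTowerClayBridge
open Summit.NavierStokesRegularity.FluidComputer.PalasekTowerClayBridge.TinyBlob
open Summit.NavierStokesRegularity.FluidComputer.PalasekTowerClayBridge.Germ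

namespace Summit.NavierStokesRegularity.EpisodeBaseTTameCarrierOfRecordHasSwirl

/-- Coordinates of the documented point `strictPt = 5e₃ + ½e₁`. [folklore] -/
theorem strictPt_apply_zero : strictPt 0 = 1 / 2 := by
  simp [strictPt, pusherCenter, e₁, e₃]

/-- [folklore] -/
theorem strictPt_apply_one : strictPt 1 = 0 := by
  simp [strictPt, pusherCenter, e₁, e₃]

/-- `(e₁ × e₃)₁ = −1`. [folklore] -/
theorem cross_e₁_e₃_apply_one : (cross e₁ e₃) 1 = -1 := by
  simp [cross, crossProduct, e₁, e₃]

/-- **The far pusher's swirl at `strictPt` is `(9/128)·Y₀(wide)`.** [folklore] -/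
theorem swirl_farPusher_strictPt : swirl farPusher strictPt = 9 / 128 * TowerRates.wide.Y 0 := by
  rw [swirl, strictPt_apply_one, zero_mul, sub_zero, strictPt_apply_zero, farPusher_strictPt,
    PiLp.smul_apply, smul_eq_mul, cross_e₁_e₃_apply_one]
  ring

/-- **The far pusher of record is not swirl-free.** [folklore] -/
theorem not_hasNoSwirl_farPusher : ¬ HasNoSwirl farPusher := fun h => by
  have h0 := h strictPt
  rw [swirl_farPusher_strictPt] at h0
  have := Host.wide_Y_zero_pos
  nlinarith

/-- Swirl is linear under scaling of the field. [folklore] -/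
theorem swirl_faintPusher (lam : ℝ) (x : EuclideanSpace ℝ (Fin 3)) :
    swirl (faintPusher lam) x = lam * swirl farPusher x := by
  simp only [swirl, faintPusher_apply, PiLp.smul_apply, smul_eq_mul]
  ring

/-- **The faint pusher `λ • farPusher` is not swirl-free for `λ ≠ 0`.** [folklore] -/
theorem not_hasNoSwirl_faintPusher {lam : ℝ} (hlam : lam ≠ 0) : ¬ HasNoSwirl (faintPusher lam) :=
  fun h => by
  have h0 := h strictPt
  rw [swirl_faintPusher, swirl_farPusher_strictPt] at h0
  have hY := Host.wide_Y_zero_pos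
  rcases mul_eq_zero.1 h0 with h1 | h1
  · exact hlam h1
  · nlinarith

variable {R : TowerRates} {a lam : ℝ}

/-- At `strictPt` (norm `≥ 5 > 1`) the carrier of record IS the faint pusher. [folklore] -/
theorem tameCarrierAt_strictPt (ha : 0 < a) (ha2 : a ≤ 1 / 2) :
    tameCarrierAt R a lam strictPt = faintPusher (lam * (R.Y 0 / TowerRates.wide.Y 0)) strictPt :=
  (tameCarrierAt_near_far (R := R) (lam := lam) ha ha2).2 strictPt
    (lt_of_lt_of_le (by norm_num) norm_strictPt_ge)

/-- **The swirl of the carrier of record at `strictPt`**: `λ (Y₀(R)/Y₀(wide)) · (9/128) Y₀(wide)`.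
[folklore] -/
theorem swirl_tameCarrierAt_strictPt (ha : 0 < a) (ha2 : a ≤ 1 / 2) :
    swirl (tameCarrierAt R a lam) strictPt =
      lam * (R.Y 0 / TowerRates.wide.Y 0) * (9 / 128 * TowerRates.wide.Y 0) := by
  have h : swirl (tameCarrierAt R a lam) strictPt =
      swirl (faintPusher (lam * (R.Y 0 / TowerRates.wide.Y 0))) strictPt := by
    simp only [swirl, tameCarrierAt_strictPt ha ha2]
  rw [h, swirl_faintPusher, swirl_farPusher_strictPt]

/-- **THE STRICT-SLOT CARRIER OF RECORD HAS SWIRL**: for `0 < a ≤ 1/2` and `λ ≠ 0`,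
`tameCarrierAt R a λ` is not swirl-free about its axis. [folklore] -/
theorem not_hasNoSwirl_tameCarrierAt (ha : 0 < a) (ha2 : a ≤ 1 / 2) (hlam : lam ≠ 0) :
    ¬ HasNoSwirl (tameCarrierAt R a lam) := fun h => by
  have h0 := h strictPt
  rw [swirl_tameCarrierAt_strictPt ha ha2] at h0
  have hY := Host.wide_Y_zero_pos
  have hYR := R.Y_pos 0
  have hq : 0 < R.Y 0 / TowerRates.wide.Y 0 := div_pos hYR hY
  rcases mul_eq_zero.1 h0 with h1 | h1
  · rcases mul_eq_zero.1 h1 with h2 | h2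
    · exact hlam h2
    · exact hq.ne' h2
  · nlinarith

/-- The same under EXACTLY the hypotheses of the slot lemma of record `levelZeroDataAt_tameCarrierAt`
(`0 < a ≤ 5/256`, `0 < λ ≤ 1`; the two `N₀`-dependent smallness conditions are not needed): every carrier
that lemma registers has swirl. [folklore] -/
theorem tameCarrierAt_of_record_hasSwirl (ha : 0 < a) (h5 : a ≤ 5 / 256) (hlam : 0 < lam) :
    ¬ HasNoSwirl (tameCarrierAt R a lam) :=
  not_hasNoSwirl_tameCarrierAt ha (h5.trans (by norm_num)) hlam.ne'

/-! ## Coaxial placement does not remove swirl -/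

/-- Swirl commutes with translation along the axis: `Γ[U(· + s e₃)](x) = Γ[U](x + s e₃)`. [folklore] -/
theorem swirl_translate_axis (U : EuclideanSpace ℝ (Fin 3) → EuclideanSpace ℝ (Fin 3)) (s : ℝ)
    (x : EuclideanSpace ℝ (Fin 3)) :
    swirl (fun y => U (y + s • e₃)) x = swirl U (x + s • e₃) := by
  simp [swirl, e₃]

/-- **Swirl-freeness is invariant under axial translation.** [folklore] -/
theorem hasNoSwirl_translate_axis_iff (U : EuclideanSpace ℝ (Fin 3) → EuclideanSpace ℝ (Fin 3)) (s : ℝ) :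
    HasNoSwirl (fun y => U (y + s • e₃)) ↔ HasNoSwirl U := by
  refine ⟨fun h x => ?_, fun h x => ?_⟩
  · have := h (x - s • e₃)
    rwa [swirl_translate_axis, sub_add_cancel] at this
  · rw [swirl_translate_axis]; exact h _

/-- **No coaxial placement of the carrier of record is swirl-free.** [folklore] -/
theorem not_hasNoSwirl_tameCarrierAt_translate_axis (ha : 0 < a) (ha2 : a ≤ 1 / 2) (hlam : lam ≠ 0)
    (s : ℝ) : ¬ HasNoSwirl (fun y => tameCarrierAt R a lam (y + s • e₃)) := by
  rw [hasNoSwirl_translate_axis_iff]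
  exact not_hasNoSwirl_tameCarrierAt ha ha2 hlam

end Summit.NavierStokesRegularity.EpisodeBaseTTameCarrierOfRecordHasSwirl

end
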